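import Literature.NumberTheory.EllipticCurves.Shintani32KohnenDiagonal
import Literature.NumberTheory.EllipticCurves.CongruentNewformLevel32
import Literature.NumberTheory.EllipticCurves.CongruentNewformCentralValues
import Literature.NumberTheory.EllipticCurves.TunnellWaldspurgerSymmetricFamilyProofs
import HarnessLib

/-!
# Tunnell's theorem on the class `3 (mod 8)`: `a(n)² = c₃ · L(E_n, 1) · √n`

[[cite: Tunnell1983Congruent, Thm. 3, pp. 328–329]] [[cite: Waldspurger1981Fourier, Cor. 2]]
[[cite: Shintani1975, §2–§3]] — the class-`3` conjunct of
`Literature.NumberTheory.EllipticCurves.Tunnell1983_a_sq_propto_L_one`, PROVED from first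
principles by the explicit Shintani/Kohnen-type theta lift at level `128`:

for `D ≡ 3 (mod 8)` square-free, `G_D = (2/√D) Φ_D` (`kohnenFamily D φ`, the lift of the
congruent-number newform `φ = congruentCuspForm32 ∈ S₂(Γ₀(32))` against the Kohnen-type kernel
on the full level-`32` lattice) lies in `S_{3/2}(128, 1)` (`kohnenFamily_mem`), whence (H1) its
class-`3` coefficients are `A_D · a(m)` (`exists_qCoeffs_eq_mul_a_three_of_mem`); (H2)
`a_{G_D}(3) = a_{G_3}(D)` (`qCoeffs_kohnenFamily_symm_three`, genus-character triviality on the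
square class); (H3) **`a_{G_D}(D) = π⁻¹ L(E_D, 1) √D`** (`qCoeffs_kohnenFamily_congruent_diag`:
the orbits of discriminant `D²` are the classes of `±(Dxy + jy²)`, their orbit data are
`∓{∞, -j/D}_φ/(2πi)` by the Manin relation, and the resulting twisted symbol sum is Birch's
formula with Gauss's sign `i√D`).  The symmetric-family algebra (`sq_eq_of_symmetricFamily`,
auxiliary index `3`, `L(E₃, 1) ≠ 0`) then gives **`Tunnell1983_a_sq_propto_L_one_three`**:
`∃ c₃, ∀ n` square-free with `n ≡ 3 (mod 8)`, `a(n)² = c₃ · L(E_n, 1) · √n`.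

No named facts; the only definition is `kohnenR` (the family of coefficients as a total function).
-/

noncomputable section

open scoped MatrixGroups ModularForm
open Complex CongruenceSubgroup
open Literature.NumberTheory.EllipticCurves.ModularForms
open Literature.NumberTheory.EllipticCurves.Shintani
open Literature.NumberTheory.QuadraticFields (jacobiChar)

namespace Literature.NumberTheory.EllipticCurves.Tunnell1983

/-- **The diagonal for the congruent-number newform**: `a_{G_D}(D) = π⁻¹ · L(E_D, 1) · √D`
(`D ≡ 3 (mod 4)` square-free). [cite: Tunnell1983Congruent, p. 329] [cite: Birch1971] -/
theorem qCoeffs_kohnenFamily_congruent_diag {D : ℕ} [NeZero D] (hsq : Squarefree D) (hD3 : D % 4 = 3) :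
    qCoeffs (kohnenFamily D congruentCuspForm32) D =
      (1 / Real.pi : ℂ) * (congruentNumberCurve D).entireLFunction 1 * (Real.sqrt D : ℂ) := by
  rw [qCoeffs_kohnenFamily_diag D hsq hD3 congruentCuspForm32, twistedSymbolSum_congruentCuspForm32,
    ← I_mul_sqrt_mul_entireLFunction_one_of_mod_four_eq_three hsq hD3]
  have hpi : (Real.pi : ℂ) ≠ 0 := by exact_mod_cast Real.pi_ne_zero
  field_simp

/-- The family of coefficients `R(D, m) = a_{G_D}(m)` as a total function (junk `0` at `D = 0`). [folklore] -/
def kohnenR (D m : ℕ) : ℂ :=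
  if hD : D = 0 then 0 else (haveI : NeZero D := ⟨hD⟩; qCoeffs (kohnenFamily D congruentCuspForm32) m)

/-- `kohnenR` unfolds for `D ≠ 0`. [folklore] -/
theorem kohnenR_eq {D : ℕ} [hD : NeZero D] (m : ℕ) :
    kohnenR D m = qCoeffs (kohnenFamily D congruentCuspForm32) m := by
  rw [kohnenR, dif_neg (NeZero.ne D)]

/-- **Tunnell's theorem, class `3 (mod 8)`**: there is a constant `c₃` with
`a(n)² = c₃ · L(E_n, 1) · √n` for every square-free `n ≡ 3 (mod 8)` — proved from the explicit
theta lift (no appeal to Waldspurger's theorem as a named fact).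
[cite: Tunnell1983Congruent, Thm. 3] [cite: Waldspurger1981Fourier, Cor. 2] -/
theorem Tunnell1983_a_sq_propto_L_one_three :
    ∃ c₃ : ℂ, ∀ ⦃n : ℕ⦄, Squarefree n → n % 8 = 3 → (congruentNumberCurve n).HasEntireLFunction →
      (a n : ℂ) ^ 2 = c₃ * (congruentNumberCurve n).entireLFunction 1 * (Real.sqrt n : ℂ) := by
  have hL := @hasEntireLFunction_congruentNumberCurve_holds
  have hκ : (1 / Real.pi : ℂ) ≠ 0 := by
    have hpi : (Real.pi : ℂ) ≠ 0 := by exact_mod_cast Real.pi_ne_zero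
    exact one_div_ne_zero hpi
  refine exists_sq_propto_of_symmetricFamily kohnenR (fun m ↦ (a m : ℂ))
    (fun D ↦ (congruentNumberCurve D).entireLFunction 1)
    (fun D ↦ (congruentNumberCurve D).HasEntireLFunction) hκ Nat.prime_three.prime.squarefree rfl
    (hL Nat.prime_three.prime.squarefree) entireLFunction_congruentNumberCurve_three_one_ne_zero
    ?_ ?_ ?_
  · -- (H1): membership in `S_{3/2}(128, 1)` and the basis theorem on the class `3`
    intro D hD h3
    haveI : NeZero D := ⟨hD.ne_zero⟩
    obtain ⟨A, hA⟩ := exists_qCoeffs_eq_mul_a_three_of_mem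
      (kohnenFamily_mem D hD (by omega) congruentCuspForm32)
    exact ⟨A, fun m hm ↦ by rw [kohnenR_eq]; exact hA hm⟩
  · -- (H2): the symmetry with the auxiliary index `3`
    intro D hD h3
    haveI : NeZero D := ⟨hD.ne_zero⟩
    haveI : NeZero (3 : ℕ) := ⟨by norm_num⟩
    rw [kohnenR_eq, kohnenR_eq]
    exact qCoeffs_kohnenFamily_symm_three D hD h3 congruentCuspForm32
  · -- (H3): the diagonal
    intro D hD h3 _
    haveI : NeZero D := ⟨hD.ne_zero⟩
    rw [kohnenR_eq]
    exact qCoeffs_kohnenFamily_congruent_diag hD (by omega)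

end Literature.NumberTheory.EllipticCurves.Tunnell1983
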